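import Summits.AnomalousDissipation.AnomalousDissipation.Theses.LoudWindows
import Summits.AnomalousDissipation.AnomalousDissipation.Theorems.LoudWindowsWeakDualitySlice
import Summits.AnomalousDissipation.AnomalousDissipation.Theorems.LoudWindowsWeakDualityChainRule
import Literature.Analysis.FluidPDE.DoeringFoiasProofs
import Literature.Analysis.FluidPDE.DoeringFoiasPowerProofs
import Literature.Analysis.FluidPDE.LerayHopfUniformEnergyMomentum
import Literature.Analysis.FluidPDE.LerayHopfSpectralMeasurability
import Literature.Analysis.FluidPDE.CylindricalTrajectory
import HarnessLib

/-!
# Route LoudWindows — support `WeakDuality` (grammar-B weak duality, the DOOR)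

If the running-cost bracket of grammar B,
`λE + [(1+2a)⟨f,v⟩ − λ‖v‖² − 2aν‖∇v‖² + Σᵢ ∂ᵢφ(coords v)·fluxᵢ(v)]`, is `≤ B` at every smooth
divergence-free field `v`, then `meanPower f u ≤ B` along every global Leray–Hopf solution with
`meanEnergy u ≤ E` (`λ, a ≥ 0`). Proof = the Leray–Hopf energy inequality (multiplier `a`), the
mean-energy budget (multiplier `λ`) and the cylindrical chain rule
`φ(c(T)) − φ(c(1)) = ∫₁ᵀ Σᵢ ∂ᵢφ(c)fluxᵢ` (bounded, so its Cesàro mean vanishes), applied to the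
a.e. time slices (part 1) and averaged in time; then `limsup`.

Decomposition cell `decomp-ad`, lens-3 lineage g61 (route LoudWindows, item
stmt-AnomalousDissipation-28927).

[cite: FoiasManleyRosaTemam2001, Ch. IV §1.2 and App. B.2] [cite: ChernyshenkoEtAl2014, §2(a)]
[cite: DoeringFoias2002, §2]
-/

noncomputable section

open MeasureTheory Filter Topology Set UnitAddTorus
open scoped ENNReal NNReal RealInnerProductSpace

namespace Summit.AnomalousDissipation.AnomalousDissipation.Theorems

open Literature.Analysis.FluidPDE Literature.Analysis.FunctionSpaces

set_option linter.dupNamespace false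

variable {d : Type*} [Fintype d] [DecidableEq d]

variable {ν : ℝ} {f u₀ : UnitAddTorus d → EuclideanSpace ℝ d} {u : ℝ → UnitAddTorus d → EuclideanSpace ℝ d}

/-- **Finite-time budget.** Along a global Leray–Hopf solution with steady smooth mean-zero force,
a grammar-B certificate (`a ≥ 0`) gives, for every `T > 0`,
`∫₀ᵀ⟨f,u⟩ ≤ (B − λE)T + λ∫₀ᵀ‖u‖² + 2a·½‖u₀‖² − ∫₀ᵀ Σᵢ ∂ᵢφ(c)fluxᵢ`
(a.e. slice bracket integrated in time + the energy inequality). [cite: DoeringFoias2002, §2] -/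
theorem weakDuality_intervalIntegral_power_le (hν : 0 < ν) (hfs : Torus.IsSmooth f)
    (hf0 : Torus.HasZeroMean f) (hu : Torus.IsGlobalLerayHopf ν (fun _ => f) u₀ u)
    (Φ : Torus.CylindricalTest d) {lam a B E : ℝ} (ha : 0 ≤ a)
    (hcert : ∀ w : UnitAddTorus d → EuclideanSpace ℝ d, Torus.IsSmooth w → Torus.IsDivFree w →
      lam * E + ((1 + 2 * a) * (∫ x, ⟪f x, w x⟫) - lam * (∫ x, ‖w x‖ ^ 2) -
        2 * a * ν * (Torus.eGradNormSq w).toReal +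
        ∑ i : Fin Φ.m, fderiv ℝ Φ.φ (WithLp.toLp 2 fun i' => ∫ x, ⟪w x, Φ.g i' x⟫)
          (EuclideanSpace.single i 1) *
          (∫ x, (⟪w x, Torus.convect w (Φ.g i) x⟫ + ν * ⟪w x, Torus.laplacian (Φ.g i) x⟫ +
            ⟪f x, Φ.g i x⟫))) ≤ B)
    {T : ℝ} (hT : 0 < T) :
    ∫ t in (0 : ℝ)..T, ∫ x, ⟪f x, u t x⟫ ≤
      (B - lam * E) * T + lam * (∫ t in (0 : ℝ)..T, ∫ x, ‖u t x‖ ^ 2) +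
        2 * a * Torus.kineticEnergy u₀ -
        ∫ t in (0 : ℝ)..T, ∑ i, fderiv ℝ Φ.φ (WithLp.toLp 2 fun i' => ∫ x, ⟪u t x, Φ.g i' x⟫)
          (EuclideanSpace.single i 1) * Torus.trajFlux ν f u (Φ.g i) t := by
  have hf : MemLp f 2 volume := hfs.memLp 2
  have hLH := hu T hT
  -- integrability of the four time series on `(0, T]`
  have hPi : IntervalIntegrable (fun t => ∫ x, ⟪f x, u t x⟫) volume 0 T :=
    hLH.intervalIntegrable_power hT hν hf hf0
  have hKi : IntervalIntegrable (fun t => ∫ x, ‖u t x‖ ^ 2) volume 0 T := by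
    rw [intervalIntegrable_iff_integrableOn_Ioc_of_le hT.le]
    exact hu.integrableOn_integral_norm_sq hT
  have hDi : IntervalIntegrable (fun t => ν * (Torus.eGradNormSq (u t)).toReal) volume 0 T :=
    (hLH.intervalIntegral_dissipation_eq hT).1
  have hGi : IntervalIntegrable (fun t => ∑ i, fderiv ℝ Φ.φ
      (WithLp.toLp 2 fun i' => ∫ x, ⟪u t x, Φ.g i' x⟫) (EuclideanSpace.single i 1) *
        Torus.trajFlux ν f u (Φ.g i) t) volume 0 T := by
    rw [intervalIntegrable_iff_integrableOn_Ioc_of_le hT.le]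
    exact weakDuality_integrableOn_chain hf hu Φ hT
  -- the bracket at a.e. time slice (stated on `[0, T]`, as `integral_mono_ae_restrict` wants)
  have hae : ∀ᵐ t ∂(volume.restrict (Icc 0 T)),
      (1 + 2 * a) * (∫ x, ⟪f x, u t x⟫) ≤
        ((B - lam * E) + lam * (∫ x, ‖u t x‖ ^ 2) +
          2 * a * (ν * (Torus.eGradNormSq (u t)).toReal)) -
          ∑ i, fderiv ℝ Φ.φ (WithLp.toLp 2 fun i' => ∫ x, ⟪u t x, Φ.g i' x⟫)
            (EuclideanSpace.single i 1) * Torus.trajFlux ν f u (Φ.g i) t := by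
    have h1 : ∀ᵐ t ∂(volume.restrict (Ioo 0 T)), Torus.eGradNormSq (u t) < ∞ :=
      ae_lt_top' hLH.aemeasurable_eGradNormSq hLH.lintegral_eGradNormSq_lt_top.ne
    have h2 : ∀ᵐ t ∂(volume.restrict (Ioo 0 T)), Torus.IsWeaklyDivFree (u t) := hLH.weak.2.2.1
    rw [← Measure.restrict_congr_set (Ioo_ae_eq_Icc (μ := (volume : Measure ℝ)) (a := 0) (b := T))]
    filter_upwards [h1, h2, ae_restrict_mem measurableSet_Ioo] with t ht hdv htmem
    have hB := weakDuality_bracket_of_smooth hf Φ hcert (hLH.memLp t (Ioo_subset_Icc_self htmem))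
      hdv ht.ne
    have hG : ∀ i : Fin Φ.m, Torus.trajFlux ν f u (Φ.g i) t =
        ∫ x, (⟪u t x, Torus.convect (u t) (Φ.g i) x⟫ + ν * ⟪u t x, Torus.laplacian (Φ.g i) x⟫ +
          ⟪f x, Φ.g i x⟫) := fun i => rfl
    simp only [hG]
    linarith
  -- integrate over `(0, T]`
  have hI1 : IntervalIntegrable (fun t => (B - lam * E) + lam * (∫ x, ‖u t x‖ ^ 2)) volume 0 T :=
    intervalIntegrable_const.add (hKi.const_mul lam)
  have hI2 : IntervalIntegrable (fun t => (B - lam * E) + lam * (∫ x, ‖u t x‖ ^ 2) +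
      2 * a * (ν * (Torus.eGradNormSq (u t)).toReal)) volume 0 T :=
    hI1.add (hDi.const_mul (2 * a))
  have hI3 : IntervalIntegrable (fun t => ((B - lam * E) + lam * (∫ x, ‖u t x‖ ^ 2) +
      2 * a * (ν * (Torus.eGradNormSq (u t)).toReal)) -
      ∑ i, fderiv ℝ Φ.φ (WithLp.toLp 2 fun i' => ∫ x, ⟪u t x, Φ.g i' x⟫)
        (EuclideanSpace.single i 1) * Torus.trajFlux ν f u (Φ.g i) t) volume 0 T :=
    hI2.sub hGi
  have hint : (1 + 2 * a) * (∫ t in (0 : ℝ)..T, ∫ x, ⟪f x, u t x⟫) ≤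
      (B - lam * E) * T + lam * (∫ t in (0 : ℝ)..T, ∫ x, ‖u t x‖ ^ 2) +
        2 * a * (∫ t in (0 : ℝ)..T, ν * (Torus.eGradNormSq (u t)).toReal) -
        ∫ t in (0 : ℝ)..T, ∑ i, fderiv ℝ Φ.φ (WithLp.toLp 2 fun i' => ∫ x, ⟪u t x, Φ.g i' x⟫)
          (EuclideanSpace.single i 1) * Torus.trajFlux ν f u (Φ.g i) t := by
    rw [← intervalIntegral.integral_const_mul]
    refine (intervalIntegral.integral_mono_ae_restrict hT.le (hPi.const_mul _) hI3 hae).trans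
      (le_of_eq ?_)
    rw [intervalIntegral.integral_sub hI2 hGi, intervalIntegral.integral_add hI1 (hDi.const_mul _),
      intervalIntegral.integral_add intervalIntegrable_const (hKi.const_mul _),
      intervalIntegral.integral_const_mul, intervalIntegral.integral_const_mul,
      intervalIntegral.integral_const, smul_eq_mul, sub_zero, mul_comm T]
  -- the energy inequality pays for the dissipation
  have hE := hLH.intervalIntegral_dissipation_le hT
  have h2a : 2 * a * (∫ t in (0 : ℝ)..T, ν * (Torus.eGradNormSq (u t)).toReal) ≤
      2 * a * (Torus.kineticEnergy u₀ + ∫ t in (0 : ℝ)..T, ∫ x, ⟪f x, u t x⟫) :=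
    mul_le_mul_of_nonneg_left hE (by positivity)
  nlinarith [hint, h2a]

/-- **Weak duality of grammar B** (general dimension): a certificate `(Φ, λ, a, B)` with
`λ, a ≥ 0` whose bracket is `≤ B` on smooth divergence-free fields bounds the mean injected power,
`meanPower f u ≤ B`, along every global Leray–Hopf solution with `meanEnergy u ≤ E`.
[cite: ChernyshenkoEtAl2014, §2(a)] [cite: FoiasManleyRosaTemam2001, Ch. IV §1.2] -/
theorem weakDuality_meanPower_le (hν : 0 < ν) (hfs : Torus.IsSmooth f)
    (hf0 : Torus.HasZeroMean f) (hu : Torus.IsGlobalLerayHopf ν (fun _ => f) u₀ u) {E : ℝ}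
    (hEm : meanEnergy u ≤ E) (Φ : Torus.CylindricalTest d) {lam a B : ℝ} (hlam : 0 ≤ lam)
    (ha : 0 ≤ a)
    (hcert : ∀ w : UnitAddTorus d → EuclideanSpace ℝ d, Torus.IsSmooth w → Torus.IsDivFree w →
      lam * E + ((1 + 2 * a) * (∫ x, ⟪f x, w x⟫) - lam * (∫ x, ‖w x‖ ^ 2) -
        2 * a * ν * (Torus.eGradNormSq w).toReal +
        ∑ i : Fin Φ.m, fderiv ℝ Φ.φ (WithLp.toLp 2 fun i' => ∫ x, ⟪w x, Φ.g i' x⟫)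
          (EuclideanSpace.single i 1) *
          (∫ x, (⟪w x, Torus.convect w (Φ.g i) x⟫ + ν * ⟪w x, Torus.laplacian (Φ.g i) x⟫ +
            ⟪f x, Φ.g i x⟫))) ≤ B) :
    meanPower f u ≤ B := by
  have hf : MemLp f 2 volume := hfs.memLp 2
  -- the Cesàro-mean budget, `T > 0`
  have hfin : ∀ T, 0 < T → timeMean (fun t => ∫ x, ⟪f x, u t x⟫) T ≤
      (B - lam * E) + lam * timeMean (fun t => ∫ x, ‖u t x‖ ^ 2) T +
        (2 * a * Torus.kineticEnergy u₀ * T⁻¹ -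
          timeMean (fun t => ∑ i, fderiv ℝ Φ.φ (WithLp.toLp 2 fun i' => ∫ x, ⟪u t x, Φ.g i' x⟫)
            (EuclideanSpace.single i 1) * Torus.trajFlux ν f u (Φ.g i) t) T) := by
    intro T hT
    have h := weakDuality_intervalIntegral_power_le hν hfs hf0 hu Φ ha hcert hT
    have hTi : 0 ≤ T⁻¹ := inv_nonneg.2 hT.le
    have hm := mul_le_mul_of_nonneg_left h hTi
    have hTT : T⁻¹ * T = 1 := inv_mul_cancel₀ hT.ne'
    simp only [timeMean]
    have e : T⁻¹ * ((B - lam * E) * T + lam * (∫ t in (0 : ℝ)..T, ∫ x, ‖u t x‖ ^ 2) +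
        2 * a * Torus.kineticEnergy u₀ -
        ∫ t in (0 : ℝ)..T, ∑ i, fderiv ℝ Φ.φ (WithLp.toLp 2 fun i' => ∫ x, ⟪u t x, Φ.g i' x⟫)
          (EuclideanSpace.single i 1) * Torus.trajFlux ν f u (Φ.g i) t) =
        (B - lam * E) * (T⁻¹ * T) + lam * (T⁻¹ * ∫ t in (0 : ℝ)..T, ∫ x, ‖u t x‖ ^ 2) +
        (2 * a * Torus.kineticEnergy u₀ * T⁻¹ - T⁻¹ *
          ∫ t in (0 : ℝ)..T, ∑ i, fderiv ℝ Φ.φ (WithLp.toLp 2 fun i' => ∫ x, ⟪u t x, Φ.g i' x⟫)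
            (EuclideanSpace.single i 1) * Torus.trajFlux ν f u (Φ.g i) t) := by ring
    rw [e, hTT, mul_one] at hm
    exact hm
  -- long-time bookkeeping
  have hKbdd : IsBoundedUnder (· ≤ ·) atTop (timeMean fun t => ∫ x, ‖u t x‖ ^ 2) :=
    hu.isBoundedUnder_timeMean_energy hν hf hf0
  have hr : Tendsto (fun T : ℝ => 2 * a * Torus.kineticEnergy u₀ * T⁻¹ -
      timeMean (fun t => ∑ i, fderiv ℝ Φ.φ (WithLp.toLp 2 fun i' => ∫ x, ⟪u t x, Φ.g i' x⟫)
        (EuclideanSpace.single i 1) * Torus.trajFlux ν f u (Φ.g i) t) T) atTop (𝓝 0) := by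
    have h := (tendsto_inv_atTop_zero.const_mul (2 * a * Torus.kineticEnergy u₀)).sub
      (weakDuality_tendsto_timeMean_chain hf hu Φ)
    rw [mul_zero, sub_zero] at h
    exact h
  -- a lower bound on the power means (coboundedness of the `limsup`)
  obtain ⟨Kb, hKb⟩ := hKbdd
  rw [eventually_map] at hKb
  have hcob : IsCoboundedUnder (· ≤ ·) atTop (timeMean fun t => ∫ x, ⟪f x, u t x⟫) := by
    refine isCoboundedUnder_le_of_eventually_le atTop
      (x := -(Real.sqrt (∫ x, ‖f x‖ ^ 2) * Real.sqrt Kb)) ?_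
    filter_upwards [hKb, eventually_gt_atTop 0] with T hT hT0
    have h := hu.abs_timeMean_power_le hfs hT0
    have hs : Real.sqrt (timeMean (fun t => ∫ x, ‖u t x‖ ^ 2) T) ≤ Real.sqrt Kb :=
      Real.sqrt_le_sqrt hT
    have hA : 0 ≤ Real.sqrt (∫ x, ‖f x‖ ^ 2) := Real.sqrt_nonneg _
    nlinarith [abs_le.1 h, mul_le_mul_of_nonneg_left hs hA]
  -- `limsup ≤ B + δ` for every `δ > 0`
  unfold meanPower longTimeAvgSup
  refine le_of_forall_pos_le_add fun δ hδ => ?_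
  have hε : 0 < δ / (lam + 1) := div_pos hδ (by linarith)
  have hev1 : ∀ᶠ T in atTop, timeMean (fun t => ∫ x, ‖u t x‖ ^ 2) T < meanEnergy u + δ / (lam + 1) := by
    refine eventually_lt_of_limsup_lt ?_ ⟨Kb, by rwa [eventually_map]⟩
    rw [meanEnergy_eq_longTimeAvgSup]
    unfold longTimeAvgSup
    linarith
  have hev2 := hr.eventually_lt_const hε
  refine limsup_le_of_le hcob ?_
  filter_upwards [hev1, hev2, eventually_gt_atTop 0] with T h1 h2 hT
  have h := hfin T hT
  have hl1 : lam * timeMean (fun t => ∫ x, ‖u t x‖ ^ 2) T ≤ lam * (meanEnergy u + δ / (lam + 1)) :=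
    mul_le_mul_of_nonneg_left h1.le hlam
  have hl2 : lam * meanEnergy u ≤ lam * E := mul_le_mul_of_nonneg_left hEm hlam
  have hεδ : (lam + 1) * (δ / (lam + 1)) = δ := by field_simp
  nlinarith [h, hl1, hl2, hεδ, h2]

/-- **`LoudWindows.WeakDuality` (grammar-B weak duality, the DOOR; `d = 3`).** For every
`ν > 0`, smooth divergence-free mean-zero `f`, global Leray–Hopf `u` with `meanEnergy u ≤ E` and
every certificate `(Φ, λ ≥ 0, a ≥ 0, B)` whose bracket is `≤ B` on smooth divergence-free fields:
`meanPower f u ≤ B`. [cite: ChernyshenkoEtAl2014, §2(a)] [cite: FoiasManleyRosaTemam2001, Ch. IV §1.2] -/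
theorem loudWindows_weakDuality :
    Summit.AnomalousDissipation.AnomalousDissipation.Theses.LoudWindows.WeakDuality := by
  intro ν hν f hf _hdiv hf0 u₀ u hu E hE Φ lam a B hB
  obtain ⟨hlam, ha, hcert⟩ := hB
  exact weakDuality_meanPower_le hν hf hf0 hu hE Φ hlam ha hcert

end Summit.AnomalousDissipation.AnomalousDissipation.Theorems

end
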